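import Literature.NumberTheory.EllipticCurves.IwasawaAlgebraInvolutionFixedPrimesProofs
import Literature.NumberTheory.EllipticCurves.IwasawaAlgebraCharIdealProofs
import HarnessLib

/-!
# Route `QuadraticBranchSignedControl` (rung K8, cell `bsd-potss`), crux `PlusEtaLowerInclusion`
# (item stmt-BirchSwinnertonDyer-19601): the FUNCTIONAL-EQUATION SQUEEZE, part 1 — the `Λ`-algebra

WHAT. The algebra brick of the functional-equation squeeze (companion road file
`…PlusEtaLowerInclusionFunctionalEquationSqueeze.lean`, same seat): in `Λ = ℤ_p⟦T⟧` with the Iwasawa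
involution `ι : T ↦ (1+T)⁻¹ − 1` (`IwasawaAlgebra.invol`), if `L = u · T^r · (T − c₁)(T − c₂)` with
`u ∈ Λˣ`, `c₁, c₂ ∈ pℤ_p ∖ {0}`, and `g` satisfies `T^r ∣ g ∣ L`, `(ι g) = (g)` and `p ∣ coeff_r g`, then
`(g) = (L)` (`span_singleton_eq_of_invol_of_feShape`). Ingredients: divisors of `u·q₁·q₂` for primes
`q₁, q₂` in a domain (`dvd_unit_mul_prime_mul_prime_cases`); the abstract squeeze
(`associated_mul_of_dvd_of_invol`: a non-unit `ι`-stable divisor of `u q₁ q₂` with neither prime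
`ι`-self-associate is `~ q₁ q₂`); `T − c` is PRIME in `Λ` for `c ∈ pℤ_p` (degree-one distinguished
polynomial; Weierstrass division, tree `span_coe_isPrime_of_dvd`); `T − c` is NEVER `ι`-self-associate
for `c ∈ pℤ_p ∖ {0}`, `p ≠ 2` (`not_associated_invol_X_sub_C`: constant and linear coefficients of
`ι(T−c)·w = T−c` give `w(0) = 1`, `c·w₁ = −2`, i.e. `c ∣ 2`); `ι T ~ T` (`associated_invol_X`).

WHY IT MATTERS (see the road file): at a tower-onto pair, Kato's divisibility gives `ξ_η ∣ Lη`, the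
signed rank bound `T^r ∣ ξ_η`, B. D. Kim's Thm. 3.11 at `η` the `ι`-stability of `(ξ_η)`, the Tamagawa
road ONE factor of `p` in `coeff_r ξ_η`; when `L_p⁺(V,η,X)/T^r` splits into two linear distinguished
factors (two `ℚ_p`-rational non-classical zeros swapped by `s ↦ −s` — the shape of the census residue
row `69150v1` at `p = 5`) this brick forces `(ξ_η) = (Lη)`, i.e. (C1⁺_η) ∧ (E⁺_η), WITHOUT the second
factor of `p` (the height index) that the valuation squeeze needs there.

HONEST FRAMING (cell `bsd-potss`, run/shared/lean/pub/bsd-potss/; FULL-BSD rank ≤ 1 programme, HUMAN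
RULING D-0036/D-0074): PURE ALGEBRA, unconditional; bears on crux 19601 only through the road file;
closes nothing; nothing is booked. No definition, no named fact, no `sorry`, axioms standard. Seat
`bsd-potss-k8eta-c1` (prover), g11; `--supports stmt-BirchSwinnertonDyer-19601`.

References: [Washington1997] §7.1 (Prop. 7.2, distinguished polynomials), §13.2 (the involution);
[MazurTateTeitelbaum1986Invent] Ch. I §17; [KimBD2008MRL] §1 p. 83 ("(a) = (a^ι)").
-/

set_option autoImplicit false
set_option linter.dupNamespace false

noncomputable section

open scoped Classical

open Literature.NumberTheory.EllipticCurves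
open Literature.NumberTheory.EllipticCurves.IwasawaAlgebra

namespace Summit.BirchSwinnertonDyer.BirchSwinnertonDyer.Theorems

/-! ## §1 `Λ`-algebra: divisors of `u·q₁·q₂`, the involution, and the functional-equation squeeze -/

section Algebra

/-- In a commutative domain: a divisor of `u · q` (`u` a unit, `q` prime) is a unit or an associate
of `q`. [folklore] -/
theorem isUnit_or_associated_of_dvd_unit_mul_prime {R : Type*} [CommRing R] [IsDomain R]
    {d u q : R} (hu : IsUnit u) (hq : Prime q) (h : d ∣ u * q) : IsUnit d ∨ Associated d q := by
  obtain ⟨e, he⟩ := h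
  have hqde : q ∣ d * e := ⟨u, by rw [← he, mul_comm]⟩
  rcases hq.dvd_or_dvd hqde with ⟨d', rfl⟩ | ⟨e', rfl⟩
  · -- `d = q d'`: `u q = q d' e` so `u = d' e`, `d'` is a unit
    right
    have h1 : u = d' * e := mul_left_cancel₀ hq.ne_zero (by rw [mul_comm q u, he]; ring)
    have hd' : IsUnit d' := isUnit_of_mul_isUnit_left (h1 ▸ hu)
    exact (associated_mul_unit_right q d' hd').symm
  · -- `e = q e'`: `u q = d q e'` so `u = d e'`, `d` is a unit
    left
    have h1 : u = d * e' := mul_left_cancel₀ hq.ne_zero (by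
      rw [mul_comm q u, he]; ring)
    exact isUnit_of_mul_isUnit_left (h1 ▸ hu)

/-- In a commutative domain: a divisor of `u · q₁ · q₂` (`u` a unit, `q₁, q₂` prime, associate or not)
is a unit, an associate of `q₁`, an associate of `q₂`, or an associate of `q₁ q₂`. [folklore] -/
theorem dvd_unit_mul_prime_mul_prime_cases {R : Type*} [CommRing R] [IsDomain R]
    {d u q₁ q₂ : R} (hu : IsUnit u) (hq₁ : Prime q₁) (hq₂ : Prime q₂) (h : d ∣ u * (q₁ * q₂)) :
    IsUnit d ∨ Associated d q₁ ∨ Associated d q₂ ∨ Associated d (q₁ * q₂) := by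
  by_cases hd : q₁ ∣ d
  · obtain ⟨d', rfl⟩ := hd
    -- `q₁ d' ∣ u q₁ q₂` so `d' ∣ u q₂`
    have h' : d' ∣ u * q₂ := by
      have h2 : q₁ * d' ∣ q₁ * (u * q₂) := by
        have : q₁ * (u * q₂) = u * (q₁ * q₂) := by ring
        rwa [this]
      exact (mul_dvd_mul_iff_left hq₁.ne_zero).mp h2
    rcases isUnit_or_associated_of_dvd_unit_mul_prime hu hq₂ h' with hd' | hd'
    · exact Or.inr (Or.inl (associated_mul_unit_right q₁ d' hd').symm)
    · exact Or.inr (Or.inr (Or.inr (hd'.mul_left q₁)))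
  · obtain ⟨e, he⟩ := h
    have hq1e : q₁ ∣ d * e := ⟨u * q₂, by rw [← he]; ring⟩
    rcases hq₁.dvd_or_dvd hq1e with h1 | ⟨e', rfl⟩
    · exact absurd h1 hd
    · -- `u q₁ q₂ = d q₁ e'` so `u q₂ = d e'`
      have h' : d ∣ u * q₂ := ⟨e', mul_left_cancel₀ hq₁.ne_zero (by
        calc q₁ * (u * q₂) = u * (q₁ * q₂) := by ring
          _ = d * (q₁ * e') := he
          _ = q₁ * (d * e') := by ring)⟩
      rcases isUnit_or_associated_of_dvd_unit_mul_prime hu hq₂ h' with hd' | hd'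
      · exact Or.inl hd'
      · exact Or.inr (Or.inr (Or.inl hd'))

/-- **The abstract functional-equation squeeze.** In a commutative domain with a ring endomorphism
`ι`: if a NON-UNIT `d` divides `u · q₁ · q₂` (`u` a unit, `q₁, q₂` prime), `(d)` is `ι`-stable
(`ι d ~ d`) and NEITHER prime is `ι`-self-associate, then `d ~ q₁ q₂`. [folklore] -/
theorem associated_mul_of_dvd_of_invol {R : Type*} [CommRing R] [IsDomain R] (ι : R →+* R)
    {d u q₁ q₂ : R} (hu : IsUnit u) (hq₁ : Prime q₁) (hq₂ : Prime q₂) (h : d ∣ u * (q₁ * q₂))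
    (hd : ¬ IsUnit d) (hι : Associated (ι d) d) (h₁ : ¬ Associated (ι q₁) q₁)
    (h₂ : ¬ Associated (ι q₂) q₂) : Associated d (q₁ * q₂) := by
  rcases dvd_unit_mul_prime_mul_prime_cases hu hq₁ hq₂ h with h0 | h0 | h0 | h0
  · exact absurd h0 hd
  · exact absurd ((h0.map (ι : R →* R)).symm.trans (hι.trans h0)) h₁
  · exact absurd ((h0.map (ι : R →* R)).symm.trans (hι.trans h0)) h₂
  · exact h0

variable (p : ℕ) [hp : Fact p.Prime]

/-- The linear coefficient of `ι T = (1+T)⁻¹ − 1 = −T + T² − ⋯` is `−1`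
(from `ι T · (1 + T) = −T`). [cite: Washington1997, §7.1 and §13.2] -/
theorem coeff_one_invSubOne : PowerSeries.coeff 1 (invSubOne p) = -1 := by
  have h := invol_X_mul_one_add_X p
  rw [invol_X, mul_add, mul_one] at h
  have h1 := congrArg (PowerSeries.coeff 1) h
  rw [map_add, PowerSeries.coeff_succ_mul_X, PowerSeries.coeff_zero_eq_constantCoeff,
    constantCoeff_invSubOne, add_zero, map_neg, PowerSeries.coeff_one_X] at h1
  exact h1

/-- `ι T` is an associate of `T` (`ι T · (−(1+T)) = T`, `1 + T ∈ Λˣ`): the augmentation prime is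
`ι`-fixed, elementwise form. [cite: MazurTateTeitelbaum1986Invent, Ch. I §17] -/
theorem associated_invol_X : Associated (invol p PowerSeries.X) (PowerSeries.X : IwasawaAlgebra p) := by
  have hu : IsUnit (1 + PowerSeries.X : IwasawaAlgebra p) := by
    rw [PowerSeries.isUnit_iff_constantCoeff]
    simp
  refine ⟨-hu.unit, ?_⟩
  rw [Units.val_neg, IsUnit.unit_spec, mul_neg, invol_X_mul_one_add_X, neg_neg]

/-- **A degree-one distinguished polynomial is prime in `Λ`**: for `c ∈ pℤ_p`, `T − c` is a prime
element of `ℤ_p⟦T⟧` (`Λ/(T − c) ≅ ℤ_p[T]/(T − c)` by Weierstrass division; tree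
`span_coe_isPrime_of_dvd`). [cite: Washington1997, §7.1 (Prop. 7.2) and §13.2] -/
theorem prime_X_sub_C {c : ℤ_[p]} (hc : (p : ℤ_[p]) ∣ c) :
    Prime (PowerSeries.X - PowerSeries.C c : IwasawaAlgebra p) := by
  let f : Polynomial ℤ_[p] := Polynomial.X - Polynomial.C c
  have hf0 : f ≠ 0 := Polynomial.X_sub_C_ne_zero c
  have hdist : f.IsDistinguishedAt (IsLocalRing.maximalIdeal ℤ_[p]) := by
    refine ⟨⟨fun {n} hn => ?_⟩, Polynomial.monic_X_sub_C c⟩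
    rw [Polynomial.natDegree_X_sub_C] at hn
    have hn0 : n = 0 := by omega
    subst hn0
    rw [Polynomial.coeff_sub, Polynomial.coeff_X_zero, Polynomial.coeff_C_zero, zero_sub,
      PadicInt.maximalIdeal_eq_span_p, Ideal.mem_span_singleton]
    exact (dvd_neg).mpr hc
  haveI : (Ideal.span {f}).IsPrime :=
    (Ideal.span_singleton_prime hf0).mpr (Polynomial.prime_X_sub_C c)
  have hprime := span_coe_isPrime_of_dvd hdist (q := f) (dvd_refl f)
  have hcoe : ((f : Polynomial ℤ_[p]) : PowerSeries ℤ_[p]) = PowerSeries.X - PowerSeries.C c := by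
    simp [f, sub_eq_add_neg, Polynomial.coe_add]
  have hne : (PowerSeries.X - PowerSeries.C c : IwasawaAlgebra p) ≠ 0 := by
    intro h0
    have h1 := congrArg (PowerSeries.coeff 1) h0
    simp at h1
  rw [hcoe] at hprime
  exact (Ideal.span_singleton_prime hne).mp hprime

/-- **A degree-one distinguished polynomial with a non-zero root is NEVER `ι`-self-associate**
(`p ≠ 2`): for `c ∈ pℤ_p ∖ {0}`, `ι(T − c) = ((1+T)⁻¹ − 1) − c` is not a unit multiple of `T − c`
(constant terms force the unit to have constant term `1`, linear terms then give `c ∣ 2`). Equivalently: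
the involution `s ↦ −s` of the cyclotomic line has no fixed point `T = c ≠ 0` in the open disc.
[cite: MazurTateTeitelbaum1986Invent, Ch. I §17] [cite: Washington1997, §13.2] -/
theorem not_associated_invol_X_sub_C (hp2 : p ≠ 2) {c : ℤ_[p]} (hc : (p : ℤ_[p]) ∣ c) (hc0 : c ≠ 0) :
    ¬ Associated (invol p (PowerSeries.X - PowerSeries.C c)) (PowerSeries.X - PowerSeries.C c) := by
  rintro ⟨w, hw⟩
  rw [map_sub, invol_X, invol_C] at hw
  -- constant terms: `(-c) · w(0) = -c`, so `w(0) = 1`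
  have h0 := congrArg PowerSeries.constantCoeff hw
  rw [map_mul, map_sub, constantCoeff_invSubOne, PowerSeries.constantCoeff_C, map_sub,
    PowerSeries.constantCoeff_X, PowerSeries.constantCoeff_C] at h0
  have hw0 : PowerSeries.constantCoeff (w : IwasawaAlgebra p) = 1 := by
    have h' : c * (PowerSeries.constantCoeff (w : IwasawaAlgebra p) - 1) = 0 := by
      linear_combination -h0
    rcases mul_eq_zero.mp h' with h'' | h''
    · exact absurd h'' hc0
    · exact sub_eq_zero.mp h''
  -- linear terms: `(-c) · w₁ + (-1) · w(0) = 1`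
  have h1 := congrArg (PowerSeries.coeff 1) hw
  rw [PowerSeries.coeff_mul, Finset.Nat.sum_antidiagonal_succ, Finset.Nat.antidiagonal_zero,
    Finset.sum_singleton] at h1
  simp only [zero_add, PowerSeries.coeff_zero_eq_constantCoeff, map_sub, constantCoeff_invSubOne,
    coeff_one_invSubOne, PowerSeries.coeff_one_X, PowerSeries.coeff_C, Nat.one_ne_zero, if_false,
    if_true, hw0] at h1
  -- so `c ∣ 2` in `ℤ_p`, hence `p ∣ 2`
  have hc2 : c ∣ (2 : ℤ_[p]) :=
    ⟨-PowerSeries.coeff 1 (w : IwasawaAlgebra p), by linear_combination -h1⟩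
  have hp2' : (p : ℤ_[p]) ∣ ((2 : ℤ) : ℤ_[p]) := by
    rw [Int.cast_ofNat]; exact hc.trans hc2
  have hlt : ‖((2 : ℤ) : ℤ_[p])‖ < 1 := (PadicInt.norm_lt_one_iff_dvd _).mpr hp2'
  have h2 : (p : ℤ) ∣ 2 := (PadicInt.norm_int_lt_one_iff_dvd 2).mp hlt
  have hp_le : p ≤ 2 := by
    have := Int.le_of_dvd (by norm_num) h2
    omega
  have := hp.out.two_le
  omega

/-- **THE FUNCTIONAL-EQUATION SQUEEZE in `ℤ_p⟦T⟧`** (`p ≠ 2`). Let `L = u · T^r · (T − c₁)(T − c₂)` with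
`u ∈ Λˣ` and `c₁, c₂ ∈ pℤ_p ∖ {0}` (the analytic shape), and let `g` satisfy `T^r ∣ g ∣ L` (rank bound
and Kato's divisibility), `ι(g) · Λ = g · Λ` (algebraic functional equation) and `p ∣ coeff_r g` (ONE
factor of `p` on the algebraic side). Then `(g) = (L)`. [cite: KimBD2008MRL, §1 p. 83 ("(a) = (a^ι)")]
[cite: Washington1997, §7.1 and §13.2] -/
theorem span_singleton_eq_of_invol_of_feShape (hp2 : p ≠ 2) {r : ℕ} {g L u : IwasawaAlgebra p}
    {c₁ c₂ : ℤ_[p]} (hu : IsUnit u) (hc₁ : (p : ℤ_[p]) ∣ c₁) (hc₂ : (p : ℤ_[p]) ∣ c₂) (hc₁0 : c₁ ≠ 0)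
    (hc₂0 : c₂ ≠ 0)
    (hL : L = u * PowerSeries.X ^ r *
      ((PowerSeries.X - PowerSeries.C c₁) * (PowerSeries.X - PowerSeries.C c₂)))
    (hXg : (PowerSeries.X : IwasawaAlgebra p) ^ r ∣ g) (hgL : g ∣ L)
    (hι : Ideal.map (invol p) (Ideal.span {g}) = Ideal.span {g})
    (hcoef : (p : ℤ_[p]) ∣ PowerSeries.coeff r g) :
    Ideal.span {g} = Ideal.span {L} := by
  obtain ⟨g', rfl⟩ := hXg
  have hX0 : (PowerSeries.X : IwasawaAlgebra p) ^ r ≠ 0 := pow_ne_zero _ PowerSeries.X_ne_zero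
  have hL' : L = PowerSeries.X ^ r *
      (u * ((PowerSeries.X - PowerSeries.C c₁) * (PowerSeries.X - PowerSeries.C c₂))) := by
    rw [hL, mul_comm u, mul_assoc]
  -- `g' ∣ u Q`
  have hg'Q : g' ∣ u * ((PowerSeries.X - PowerSeries.C c₁) * (PowerSeries.X - PowerSeries.C c₂)) := by
    rw [hL'] at hgL
    exact (mul_dvd_mul_iff_left hX0).mp hgL
  -- `p ∣ g'(0)`, so `g'` is not a unit
  have hcoef' : (p : ℤ_[p]) ∣ PowerSeries.constantCoeff g' := by
    rw [PowerSeries.coeff_X_pow_mul', if_pos le_rfl, Nat.sub_self,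
      PowerSeries.coeff_zero_eq_constantCoeff] at hcoef
    exact hcoef
  have hnu : ¬ IsUnit g' := by
    intro hgu
    rw [PowerSeries.isUnit_iff_constantCoeff] at hgu
    obtain ⟨t, ht⟩ := hcoef'
    rw [ht] at hgu
    exact PadicInt.prime_p.not_unit (isUnit_of_mul_isUnit_left hgu)
  -- `(g')` is `ι`-stable
  have hιX : Associated (invol p PowerSeries.X ^ r) ((PowerSeries.X : IwasawaAlgebra p) ^ r) :=
    (associated_invol_X p).pow_pow
  have hιX0 : invol p PowerSeries.X ^ r ≠ 0 := fun h0 => hX0 (hιX.eq_zero_iff.mp h0)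
  have hιg : Associated (invol p g') g' := by
    rw [Ideal.map_span, Set.image_singleton, map_mul, map_pow] at hι
    have hassoc : Associated (invol p PowerSeries.X ^ r * invol p g') (PowerSeries.X ^ r * g') :=
      Ideal.span_singleton_eq_span_singleton.mp hι
    exact hassoc.of_mul_left hιX hιX0
  -- the squeeze
  have hg'assoc : Associated g'
      ((PowerSeries.X - PowerSeries.C c₁) * (PowerSeries.X - PowerSeries.C c₂)) :=
    associated_mul_of_dvd_of_invol (invol p).toRingHom hu (prime_X_sub_C p hc₁) (prime_X_sub_C p hc₂)
      hg'Q hnu hιg (not_associated_invol_X_sub_C p hp2 hc₁ hc₁0)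
      (not_associated_invol_X_sub_C p hp2 hc₂ hc₂0)
  have hfin : Associated (PowerSeries.X ^ r * g')
      (PowerSeries.X ^ r * (u * ((PowerSeries.X - PowerSeries.C c₁) * (PowerSeries.X - PowerSeries.C c₂)))) :=
    (hg'assoc.mul_left (PowerSeries.X ^ r)).trans
      ((associated_unit_mul_right _ u hu).mul_left (PowerSeries.X ^ r))
  rw [hL']
  exact Ideal.span_singleton_eq_span_singleton.mpr hfin

/-- The `r`-th coefficient of the shape `u · T^r · (T − c₁)(T − c₂)` is `u(0) · c₁ c₂ ≠ 0`
(so the analytic order is exactly `r`). [cite: Washington1997, §7.1] -/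
theorem coeff_ne_zero_of_feShape {r : ℕ} {L u : IwasawaAlgebra p} {c₁ c₂ : ℤ_[p]} (hu : IsUnit u)
    (hc₁0 : c₁ ≠ 0) (hc₂0 : c₂ ≠ 0)
    (hL : L = u * PowerSeries.X ^ r *
      ((PowerSeries.X - PowerSeries.C c₁) * (PowerSeries.X - PowerSeries.C c₂))) :
    PowerSeries.coeff r L ≠ 0 := by
  have hL' : L = PowerSeries.X ^ r *
      (u * ((PowerSeries.X - PowerSeries.C c₁) * (PowerSeries.X - PowerSeries.C c₂))) := by
    rw [hL]; ring
  rw [hL', PowerSeries.coeff_X_pow_mul', if_pos le_rfl, Nat.sub_self,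
    PowerSeries.coeff_zero_eq_constantCoeff]
  simp only [map_mul, map_sub, PowerSeries.constantCoeff_X, PowerSeries.constantCoeff_C, zero_sub,
    neg_mul_neg]
  have hu0 : PowerSeries.constantCoeff u ≠ 0 :=
    (PowerSeries.isUnit_iff_constantCoeff.mp hu).ne_zero
  exact mul_ne_zero hu0 (mul_ne_zero hc₁0 hc₂0)

end Algebra

end Summit.BirchSwinnertonDyer.BirchSwinnertonDyer.Theorems

end
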